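import Literature.NumberTheory.GaloisRepresentations.FundamentalCharacterCyclotomicProofs
import Literature.NumberTheory.GaloisRepresentations.FramedRepTwist
import HarnessLib

/-!
# Level-one inertia shapes under twists by powers of the cyclotomic character, and reduction of the
# exponents modulo `q − 1`

Topic `NumberTheory/GaloisRepresentations`.  A *proofs* file (theorems only: no definition, no named fact, no `sorry`,
no instance, no notation).  For a two-dimensional mod-`p` representation `ρ̄_F : Γ_F → GL₂(k)` of a non-archimedean local
field `F` with level-one inertia shape `ρ̄|I_F ∼ (ψ₁^a ∗; 0 ψ₁^b)` (`ModPGaloisRep.HasLevelOneInertiaShape ι ϖ hϖ a b`,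
`ψ₁` the fundamental character of level one, Serre 1987 §2.1):

* `HasLevelOneInertiaShape.of_modEq` — the exponents only matter modulo `q − 1` (`ψ₁^{q−1} = 1`,
  `fundamentalCharacter_one_pow_eq_one`): shape `(a, b)` ⟹ shape `(a', b')` whenever `a ≡ a'`, `b ≡ b'` `[MOD q − 1]`;
* `HasLevelOneInertiaShape.twist` — if a continuous character `χ : Γ_F → kˣ` restricts to `I_F` as `ψ₁^t`, then the twist
  `ρ̄ ⊗ χ` (`FramedRep.twist`) has shape `(a + t, b + t)` (Serre 1987 §2.2: twisting by `χ^m` adds `m` to both exponents);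
* `HasLevelOneInertiaShape.twist_modPCyclotomicCharacter_pow` — the case `χ = ω^t`, `ω` the mod-`p` cyclotomic character of
  `Γ_F` (`modPCyclotomicCharacter F k p ι'`), for `F` with residue field `𝔽_p` and uniformiser `p` (so `ψ₁ = ω|I_F`,
  `coe_fundamentalCharacter_one_eq_modPCyclotomicCharacter`): shape `(a, b)` ⟹ `ρ̄ ⊗ ω^t` has shape `(a + t, b + t)`.

Consumer: route BSD/TeichmullerTwistDescent, crux `TwistedPeriodLatticeSaturation`, input (W‴): the Serre weight of the
Teichmüller twist `ω^b ⊗ ρ̄_E` from Kraus's shape `(1 − b, b)` of `ρ̄_E` (`Kraus1997/PTorsionInertiaPotentiallyGoodOrdinary`).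

References: J.-P. Serre, Duke Math. J. 54 (1987), §2.1–2.2 [Serre1987]; B. Edixhoven, Invent. Math. 109 (1992), §4.3 [Edixhoven1992].
-/

noncomputable section

open scoped Valued MatrixGroups
open Field ValuativeRel

namespace Literature.NumberTheory.GaloisRepresentations

open GaloisRepresentations.IsNonarchimedeanLocalField

universe u v

variable {F : Type u} [Field F] [ValuativeRel F] [TopologicalSpace F] [IsNonarchimedeanLocalField F]
variable {k : Type v} [Field k] [TopologicalSpace k] [IsTopologicalRing k]

namespace ModPGaloisRep

omit [IsTopologicalRing k] in
/-- **The exponents of a level-one inertia shape only matter modulo `q − 1`**: `ψ₁` has order dividing `q − 1`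
(`fundamentalCharacter_one_pow_eq_one`), so `(ψ₁^a ∗; 0 ψ₁^b) = (ψ₁^{a'} ∗; 0 ψ₁^{b'})` for `a ≡ a'`, `b ≡ b'` modulo `q − 1`.
[cite: Serre1987, §2.1 (2.1.2)–(2.1.3)] -/
theorem HasLevelOneInertiaShape.of_modEq {ρ : ModPGaloisRep F k 2}
    {ι : absIntegers 𝒪[F] F ⧸ absMaximalIdeal F →+* k} {ϖ : 𝒪[F]} {hϖ : Irreducible ϖ} {a b a' b' : ℕ}
    (h : ρ.HasLevelOneInertiaShape ι ϖ hϖ a b) (ha : a ≡ a' [MOD residueFieldCard F - 1])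
    (hb : b ≡ b' [MOD residueFieldCard F - 1]) :
    ρ.HasLevelOneInertiaShape ι ϖ hϖ a' b' := by
  obtain ⟨P, hP⟩ := h
  refine ⟨P, fun σ => ?_⟩
  obtain ⟨c, hc⟩ := hP σ
  refine ⟨c, ?_⟩
  have hord := fundamentalCharacter_one_pow_eq_one F ι ϖ hϖ
  have hpow : ∀ {m m' : ℕ}, m ≡ m' [MOD residueFieldCard F - 1] →
      fundamentalCharacter F 1 ι ϖ hϖ σ ^ m = fundamentalCharacter F 1 ι ϖ hϖ σ ^ m' := by
    intro m m' hmm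
    have h1 : fundamentalCharacter F 1 ι ϖ hϖ σ ^ (residueFieldCard F - 1) = 1 := by
      rw [← MonoidHom.pow_apply, hord, MonoidHom.one_apply]
    rw [← Nat.mod_add_div m (residueFieldCard F - 1), ← Nat.mod_add_div m' (residueFieldCard F - 1), pow_add, pow_add,
      pow_mul, pow_mul, h1, one_pow, one_pow, mul_one, mul_one, hmm]
  rw [hc, hpow ha, hpow hb]

/-- **Twisting adds the exponent of the twist to both exponents of a level-one inertia shape**: if
`χ|_{I_F} = ψ₁^t` (as `k`-valued functions on inertia) and `ρ̄|I_F ∼ (ψ₁^a ∗; 0 ψ₁^b)`, then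
`(ρ̄ ⊗ χ)|I_F ∼ (ψ₁^{a+t} ∗; 0 ψ₁^{b+t})` in the same basis. [cite: Serre1987, §2.2] -/
theorem HasLevelOneInertiaShape.twist {ρ : ModPGaloisRep F k 2}
    {ι : absIntegers 𝒪[F] F ⧸ absMaximalIdeal F →+* k} {ϖ : 𝒪[F]} {hϖ : Irreducible ϖ} {a b : ℕ}
    (h : ρ.HasLevelOneInertiaShape ι ϖ hϖ a b) (χ : absoluteGaloisGroup F →ₜ* kˣ) (t : ℕ)
    (hχ : ∀ σ : absInertia F, (χ (σ : absoluteGaloisGroup F) : k) = ((fundamentalCharacter F 1 ι ϖ hϖ σ ^ t : kˣ) : k)) :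
    ModPGaloisRep.HasLevelOneInertiaShape (FramedRep.twist ρ χ : ModPGaloisRep F k 2) ι ϖ hϖ (a + t) (b + t) := by
  obtain ⟨P, hP⟩ := h
  refine ⟨P, fun σ => ?_⟩
  obtain ⟨c, hc⟩ := hP σ
  refine ⟨(χ (σ : absoluteGaloisGroup F) : k) * c, ?_⟩
  rw [FramedRep.conj_twist_apply, Units.val_mul, FramedRep.coe_scalar_apply, hc, Matrix.algebraMap_eq_diagonal,
    hχ σ]
  ext i j
  fin_cases i <;> fin_cases j <;>
    simp [Matrix.mul_apply, Matrix.diagonal, pow_add, mul_comm]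

/-- **Twisting by a power of the mod-`p` cyclotomic character.**  Let `F` have residue field `𝔽_p` and uniformiser `p`
(e.g. `F = ℚ_p`), so that the level-one fundamental character is the cyclotomic character on inertia
(`coe_fundamentalCharacter_one_eq_modPCyclotomicCharacter'`).  If `ρ̄|I_F ∼ (ψ₁^a ∗; 0 ψ₁^b)` then
`(ρ̄ ⊗ ω^t)|I_F ∼ (ψ₁^{a+t} ∗; 0 ψ₁^{b+t})`, `ω = modPCyclotomicCharacter F k p ι'`. [cite: Serre1987, §2.2] -/
theorem HasLevelOneInertiaShape.twist_modPCyclotomicCharacter_pow {p : ℕ} [Fact p.Prime] [NeZero ((p : ℕ) : F)]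
    {ρ : ModPGaloisRep F k 2} {ι : absIntegers 𝒪[F] F ⧸ absMaximalIdeal F →+* k} {ϖ : 𝒪[F]} {hϖ : Irreducible ϖ}
    {a b : ℕ} (h : ρ.HasLevelOneInertiaShape ι ϖ hϖ a b) (hirr : Irreducible (p : 𝒪[F]))
    (hq : residueFieldCard F = p) (ι' : ZMod p →+* k) (t : ℕ) :
    ModPGaloisRep.HasLevelOneInertiaShape
      (FramedRep.twist ρ (modPCyclotomicCharacter F k p ι' ^ t) : ModPGaloisRep F k 2) ι ϖ hϖ (a + t) (b + t) := by
  refine h.twist _ t fun σ => ?_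
  rw [ContinuousMonoidHom.pow_apply, Units.val_pow_eq_pow_val, Units.val_pow_eq_pow_val,
    coe_fundamentalCharacter_one_eq_modPCyclotomicCharacter' hirr hq ι ι' hϖ σ]

end ModPGaloisRep

end Literature.NumberTheory.GaloisRepresentations
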